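import Summits.QuantumFields.YangMills.Theorems.UnitScaleTiltProp7TowerDPDstarPointRowFlat
import Summits.QuantumFields.YangMills.Theorems.UnitScaleTiltProp7FlatGaugeProjectorTower
import Summits.QuantumFields.YangMills.Theorems.UnitScaleTiltProp7HqVOfTraceBound
import Summits.QuantumFields.YangMills.Theorems.UnitScaleTiltProp7RieszTauFrobNormT3
import Literature.MathematicalPhysics.QuantumFieldTheory.Balaban1983to89.B9Eq33CovDerivLocalLetterTower
import Literature.MathematicalPhysics.QuantumFieldTheory.Balaban1983to89.T3Thm1Carrier
import HarnessLib

/-!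
# Route `UnitScaleTilt`, crux K1 «MinimiserStabilityRegPr» (stmt-QuantumFields-19200), stub `stub_existenceMinimalOrbit` (EX) — N06 print row `h349` of the EX display
# (S31ᴸ∕S32ᴸ :245–:250), FLAT-CERTIFICATE ROAD, FILE 4∕4 «THE MEMBER KNIT»: **`h349_at_one` — THE DISPLAYED (3.49) ONE-BOND KERNEL ROW OF `D_{U₀}(1 − R_S(U₀))D_{U₀}*` AT THE
# FLAT MEMBER `U₀ := 1`, FOR EVERY MEMBER `(F, n < K)` OF EVERY BLOCK SIZE `L`, WITH `L`-ONLY CONSTANTS `C349 δ349`** — the A6ᶜ-class certificate that the displayed letter of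
# [Balaban1985BackgroundPropagators] (3.49) p. 399 is inhabited and correctly powered (`ℓ⁻³ = (L^{K−n})⁻³`) at the trivial background (★★OWNER g30 WORD 5, ★w2-19200 g8 GO)

Cell `ym3-torus`, width seat `ym3-torus-px20` (gen 6).  THEOREMS ONLY (0 `def`, 0 `sorry`); `--supports stmt-QuantumFields-19200 --as helper`, count-neutral.  YM₃ on T³ is a ladder
rung (R3), not d = 4, not infinite volume, not the Clay problem.  THIS DISCHARGES NO DISPLAYED ROW: the display's `h349` is at CURVED `U₀ ∈ RegPr` (memo §5 records the road
«tower letters ∘ gauge covariance ∘ `hThm2S`-class gauge», not claimed); nothing of N06, the stub, the crux or the mass gap is claimed.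

HOW (memo `LOCATE-H349-FLATCERT-TOWER-px20g6.md` §4).  FILE 2 ✓`Prop7TowerDPDstarPointRowFlat.exists_pointRow_DPDstar_tower_one` gives the row on the NE9 tower carrier
`towerP L (N_{K−n}) (K−n−1+1)` at `U ≡ 1`, `∃ (C, δ)` before the height; FILE 3b ✓`Prop7FlatGaugeProjectorTower.siteL2Cast_RS_one` identifies the route's `R_S(1)` with the
tower's `R_k(1)` along ✓`periodsT3_eq_towerP`; the flat `D_1`, `D_1* = D_1†` (✓`adjoint_DL2`) and the one-bond source cross the cast by lit ✓`covDerivL2K_siteL2Cast` ∕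
✓`covDivL2K_bondL2Cast` ∕ ✓`equiv_bondL2Cast`; the display's `ℓ¹` block distance `Site.tdist ∘ iterBlockOf (K−n)` is at most `3·`(the tower's sup block distance) `+ 6` across the
tip∕base blocks (§1, lit ✓`tdist_bigBlock_bpos_btgt_le_one`, ✓`circAbs_le_tdist`), so `δ349 := δ∕3`, `C349 := √2·e^{2δ}·C`.

WHAT IS PROVED (ns `Summit.QuantumFields.YangMills.Theorems.Prop7Flat349Certificate`).
* §1 `min_val_le_circAbs`, `tdist_iterBlockOf_le` (the distance dictionary), `bigBlock_bpos_val` .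
* §2 `DL2_one_eq`, `DstarL2_one_eq`, `bondL2Cast_toL2_single`, ★★`bondL2Cast_DPDstar_one` (the route's `D_1(1 − R_S(1))D_1*χ_b` IS the tower's `D_1(1 − R_k(1))D_1†χ_{b₁}` across the cast).
* §3 ★★★`h349_at_one` — S31ᴸ's `h349` row VERBATIM at `U₀ := 1` (the `RegPr` antecedent dropped — it is ✓`regPr_one`-trivial), `C349 δ349` ∃-quantified after `∀ L, 1 < L`.
HONEST SCOPE.  Certificate at the flat member only; bookkeeping over FILEs 1–3 and landed letters; rung R3, not Clay; YM gap NOT proved.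

References: T. Bałaban, CMP **99** (1985) 389–434 [Balaban1985BackgroundPropagators] ((3.49) p.399, (3.21)–(3.25) p.394, (3.11) p.392, (3.3)∕(3.8) pp.391–392);
CMP **102** (1985) 277–309 [Balaban1985Variational] (p.299 l.13).
-/

set_option autoImplicit false

noncomputable section

open scoped InnerProductSpace ComplexConjugate Matrix.Norms.L2Operator BigOperators

namespace Summit.QuantumFields.YangMills.Theorems.Prop7Flat349Certificate

open Literature.MathematicalPhysics.QuantumFieldTheory.Balaban1983to89
open Literature.MathematicalPhysics.QuantumFieldTheory.Balaban1983to89.T3ContinuumYM3Torus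
open Literature.MathematicalPhysics.QuantumFieldTheory.Balaban1983to89.T3Thm1Carrier (Idx)
open T3SectALandauChart (eta eta_pos)
open B4Sect5Torus (TSite tdist tdist_nonneg tdist_symm tdist_triangle circAbs_le_tdist)
open B4TorusKernel.MultiPeriod (circAbs)
open B9SectCLatticeCarrier (Bond bpos btgt)
open B9Eq311L2Pairing (WL2)
open B9Eq319QprimeTorus (blockCoord)
open B5Eq118OneStroke (iterBlockOf val_iterBlockOf)
open B11Eq103H1Complex (SiteL2K BondL2K covDerivL2K covDivL2K adjoint_covDerivL2K)
open B9Eq310HessianOperator (adTransportW)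
open B9Eq315QTower (towerP)
open B9Eq316TowerFlatIsOneStep (towerP_eq_fineP_pow siteCast siteCast_apply_val bondCast bondCast_apply siteL2Cast bondL2Cast equiv_bondL2Cast covDerivL2K_siteL2Cast covDivL2K_bondL2Cast)
open B9Eq326OperatorTower (RofUk)
open B9Eq342TowerBigBlocks (bigBlock_apply_val)
open B9Eq33CovDerivLocalLetterTower (tdist_bigBlock_bpos_btgt_le_one)
open Summit.QuantumFields.YangMills.Theorems.Prop7SectET3Transport (periodsT3 siteEquiv siteEquiv_apply bondEquiv bpos_bondEquiv bgOfCfg)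
open Summit.QuantumFields.YangMills.Theorems.Prop7SectET3HilbertLetters (W₂ frobEquiv toL2 toL2_apply toL2_symm_apply DL2 DstarL2 adjoint_DL2 adBgInv)
open Summit.QuantumFields.YangMills.Theorems.Prop7SectET3GaugeProjector (RS)
open Summit.QuantumFields.YangMills.Theorems.Prop7BlockPoincareKerQprime (periodsT3_eq_towerP DL2_eq_covDerivL2K)
open Summit.QuantumFields.YangMills.Theorems.Prop7LaplaceAFlatLetters (bgOfCfg_one)
open Summit.QuantumFields.YangMills.Theorems.Prop7RieszTauFrobNorm (norm_frobEquiv_le norm_frobEquiv_symm_le)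
open Summit.QuantumFields.YangMills.Theorems.Prop7HqVOfTraceBound (norm_trace_clm_le)
open Summit.QuantumFields.YangMills.Theorems.Prop7FlatGaugeProjectorTower (siteL2Cast_RS_one adTransportW_one_eq adBgInv_one_eq)
open Summit.QuantumFields.YangMills.Theorems.Prop7TowerDPDstarPointRowFlat (exists_pointRow_DPDstar_tower_one)

/-! ## §1 The distance dictionary: the display's `ℓ¹` block distance against the tower's sup block distance -/

/-- The route's per-coordinate circular distance is at most lit-balaban's `circAbs`: `min((a−b).val, (b−a).val) ≤ dist(a.val − b.val, Nℤ)`. [folklore] -/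
theorem min_val_le_circAbs {N : ℕ} [NeZero N] (a b : ZMod N) : ((min (a - b).val (b - a).val : ℕ) : ℤ) ≤ circAbs N ((a.val : ℤ) - (b.val : ℤ)) := by
  have hN : (0 : ℤ) < N := by exact_mod_cast Nat.pos_of_ne_zero (NeZero.ne N)
  have hab : a - b = (((a.val : ℤ) - (b.val : ℤ) : ℤ) : ZMod N) := by
    push_cast; rw [ZMod.natCast_zmod_val, ZMod.natCast_zmod_val]
  have hba : b - a = ((-((a.val : ℤ) - (b.val : ℤ)) : ℤ) : ZMod N) := by
    push_cast; rw [ZMod.natCast_zmod_val, ZMod.natCast_zmod_val]; ring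
  have h1 : (((a - b).val : ℕ) : ℤ) = ((a.val : ℤ) - (b.val : ℤ)) % N := by rw [hab, ZMod.val_intCast]
  have h2 : (((b - a).val : ℕ) : ℤ) = (-((a.val : ℤ) - (b.val : ℤ))) % N := by rw [hba, ZMod.val_intCast]
  set z : ℤ := (a.val : ℤ) - (b.val : ℤ) with hz
  -- `(−z) % N ≤ N − z % N`: the two residues sum to a multiple of `N` in `[0, 2N)`
  have hneg : (-z) % (N : ℤ) ≤ N - z % N := by
    have hr0 : 0 ≤ z % N := Int.emod_nonneg _ hN.ne'
    have hrN : z % N < N := Int.emod_lt_of_pos _ hN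
    have hq0 : 0 ≤ (-z) % (N : ℤ) := Int.emod_nonneg _ hN.ne'
    have hqN : (-z) % (N : ℤ) < N := Int.emod_lt_of_pos _ hN
    obtain ⟨k, hk⟩ : ∃ k : ℤ, (-z) % N + z % N = N * k :=
      ⟨-((-z) / N + z / N), by rw [Int.emod_def, Int.emod_def]; ring⟩
    have hk2 : (N : ℤ) * k < N * 2 := by linarith
    have hk1 : k ≤ 1 := by
      have := lt_of_mul_lt_mul_left hk2 hN.le
      omega
    nlinarith
  calc ((min (a - b).val (b - a).val : ℕ) : ℤ) = min ((((a - b).val : ℕ) : ℤ)) (((b - a).val : ℕ) : ℤ) := by push_cast; rfl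
    _ = min (z % N) ((-z) % N) := by rw [h1, h2]
    _ ≤ min (z % N) (N - z % N) := min_le_min le_rfl hneg
    _ = circAbs N z := rfl

/-- `((ZMod.finEquiv N)⁻¹ z).val = z.val`. [folklore] -/
private theorem val_finEquiv_symm' {N : ℕ} [NeZero N] (z : ZMod N) : (((ZMod.finEquiv N).symm z : Fin N) : ℕ) = z.val := by
  cases N with
  | zero => exact absurd rfl (NeZero.ne 0)
  | succ N => rfl

variable (F : T3Family) (n K : ℕ) (hnK : n < K) (c₀ : ℝ) [Fact (0 < c₀)] (cB : ℝ) [Fact (0 < cB)]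

omit [Fact (0 < c₀)] [Fact (0 < cB)] in
/-- The coarse label of the tower's big block of the chart of a fine site is the label of the route's `(K−n)`-fold block point. [cite: Balaban1984PropagatorsI, (1.18) p.20] -/
theorem bigBlock_chart_val [NeZero F.L] (x : Site (F.P K) 0) (i : Fin 3) :
    ((blockCoord (F.L ^ (K - n - 1 + 1)) (fun _ : Fin 3 => (F.P K).sitesPerDir (K - n))
        (siteCast (towerP_eq_fineP_pow F.L (fun _ : Fin 3 => (F.P K).sitesPerDir (K - n)) (K - n - 1 + 1))
          (siteCast (periodsT3_eq_towerP F n K hnK) (siteEquiv F K x)))) i : ℕ) = (iterBlockOf (K - n) x i).val := by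
  have hk : K - n ≤ (F.P K).m + (F.P K).K := by
    show K - n ≤ F.m + K
    exact le_trans (Nat.sub_le K n) (Nat.le_add_left K F.m)
  have hKn : K - n - 1 + 1 = K - n := Nat.sub_add_cancel (Nat.le_sub_of_add_le' hnK)
  rw [bigBlock_apply_val, siteCast_apply_val, siteEquiv_apply, hKn, val_finEquiv_symm']
  exact (val_iterBlockOf (K - n) hk x i).symm

omit [Fact (0 < c₀)] [Fact (0 < cB)] in
/-- **THE DISTANCE DICTIONARY**: the display's `ℓ¹` torus distance of the `(K−n)`-block points is at most `3` times the tower's sup torus distance of the big blocks of the charts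
(coordinate by coordinate `min((a−b).val,(b−a).val) ≤ circAbs ≤ sup`). [cite: Balaban1985BackgroundPropagators, (3.49) p.399 («d(y,y′)»)] -/
theorem tdist_iterBlockOf_le [NeZero F.L] (x x' : Site (F.P K) 0) :
    (Site.tdist (iterBlockOf (K - n) x) (iterBlockOf (K - n) x') : ℝ) ≤
      3 * tdist (fun _ : Fin 3 => (F.P K).sitesPerDir (K - n))
        (blockCoord (F.L ^ (K - n - 1 + 1)) (fun _ : Fin 3 => (F.P K).sitesPerDir (K - n))
          (siteCast (towerP_eq_fineP_pow F.L (fun _ : Fin 3 => (F.P K).sitesPerDir (K - n)) (K - n - 1 + 1))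
            (siteCast (periodsT3_eq_towerP F n K hnK) (siteEquiv F K x))))
        (blockCoord (F.L ^ (K - n - 1 + 1)) (fun _ : Fin 3 => (F.P K).sitesPerDir (K - n))
          (siteCast (towerP_eq_fineP_pow F.L (fun _ : Fin 3 => (F.P K).sitesPerDir (K - n)) (K - n - 1 + 1))
            (siteCast (periodsT3_eq_towerP F n K hnK) (siteEquiv F K x')))) := by
  set Y := blockCoord (F.L ^ (K - n - 1 + 1)) (fun _ : Fin 3 => (F.P K).sitesPerDir (K - n))
    (siteCast (towerP_eq_fineP_pow F.L (fun _ : Fin 3 => (F.P K).sitesPerDir (K - n)) (K - n - 1 + 1)) (siteCast (periodsT3_eq_towerP F n K hnK) (siteEquiv F K x))) with hY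
  set Y' := blockCoord (F.L ^ (K - n - 1 + 1)) (fun _ : Fin 3 => (F.P K).sitesPerDir (K - n))
    (siteCast (towerP_eq_fineP_pow F.L (fun _ : Fin 3 => (F.P K).sitesPerDir (K - n)) (K - n - 1 + 1)) (siteCast (periodsT3_eq_towerP F n K hnK) (siteEquiv F K x'))) with hY'
  have hm : ∀ i : Fin 3, 1 ≤ (fun _ : Fin 3 => (F.P K).sitesPerDir (K - n)) i := fun _ => Nat.one_le_iff_ne_zero.2 (NeZero.ne _)
  -- coordinate by coordinate
  have hcoord : ∀ μ : Fin (F.P K).d,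
      ((min (iterBlockOf (K - n) x μ - iterBlockOf (K - n) x' μ).val (iterBlockOf (K - n) x' μ - iterBlockOf (K - n) x μ).val : ℕ) : ℝ) ≤
        tdist (fun _ : Fin 3 => (F.P K).sitesPerDir (K - n)) Y Y' := by
    intro μ
    have h1 := min_val_le_circAbs (iterBlockOf (K - n) x μ) (iterBlockOf (K - n) x' μ)
    have h2 := circAbs_le_tdist hm Y Y' μ
    have hYv : ((Y μ : ℕ) : ℤ) = ((iterBlockOf (K - n) x μ).val : ℤ) := by rw [hY]; exact_mod_cast bigBlock_chart_val F n K hnK x μ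
    have hY'v : ((Y' μ : ℕ) : ℤ) = ((iterBlockOf (K - n) x' μ).val : ℤ) := by rw [hY']; exact_mod_cast bigBlock_chart_val F n K hnK x' μ
    rw [hYv, hY'v] at h2
    have h1' : ((min (iterBlockOf (K - n) x μ - iterBlockOf (K - n) x' μ).val (iterBlockOf (K - n) x' μ - iterBlockOf (K - n) x μ).val : ℕ) : ℝ) ≤
        (circAbs ((F.P K).sitesPerDir (K - n)) (((iterBlockOf (K - n) x μ).val : ℤ) - ((iterBlockOf (K - n) x' μ).val : ℤ)) : ℝ) := by exact_mod_cast h1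
    exact h1'.trans h2
  unfold Site.tdist
  rw [Nat.cast_sum]
  calc ∑ μ : Fin (F.P K).d, ((min (iterBlockOf (K - n) x μ - iterBlockOf (K - n) x' μ).val (iterBlockOf (K - n) x' μ - iterBlockOf (K - n) x μ).val : ℕ) : ℝ)
      ≤ ∑ _μ : Fin (F.P K).d, tdist (fun _ : Fin 3 => (F.P K).sitesPerDir (K - n)) Y Y' := Finset.sum_le_sum fun μ _ => hcoord μ
    _ = 3 * tdist (fun _ : Fin 3 => (F.P K).sitesPerDir (K - n)) Y Y' := by
        rw [Finset.sum_const, Finset.card_univ, nsmul_eq_mul]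
        show ((Fintype.card (Fin 3) : ℕ) : ℝ) * _ = _
        rw [Fintype.card_fin]; norm_num

/-! ## §2 The route's flat `D_1 (1 − R_S(1)) D_1*` on a one-bond source IS the tower's, across the period cast -/

omit [Fact (0 < cB)] in
/-- `D_1` of the member = `covDerivL2K` with identity transporters. [cite: Balaban1985BackgroundPropagators, (3.3) p.391] -/
theorem DL2_one_eq : DL2 F n K c₀ (1 : GaugeField (F.P K) 0 (Matrix.specialUnitaryGroup (Fin 2) ℂ)) =
    covDerivL2K ℂ c₀ (((eta F n K : ℝ) : ℂ)⁻¹) (fun _ : Bond 3 (periodsT3 F K) => (LinearMap.id : W₂ →ₗ[ℂ] W₂)) := by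
  rw [DL2_eq_covDerivL2K]
  have h1 : bgOfCfg F K (1 : GaugeField (F.P K) 0 (Matrix.specialUnitaryGroup (Fin 2) ℂ)) = fun _ => 1 := funext fun p => bgOfCfg_one p
  rw [h1, adTransportW_one_eq]

omit [Fact (0 < cB)] in
/-- `D_1* = D_1†` of the member = `covDivL2K` with identity transporters. [cite: Balaban1985BackgroundPropagators, (3.8) p.392] -/
theorem DstarL2_one_eq : DstarL2 F n K c₀ (1 : GaugeField (F.P K) 0 (Matrix.specialUnitaryGroup (Fin 2) ℂ)) =
    covDivL2K ℂ c₀ (((eta F n K : ℝ) : ℂ)⁻¹) (fun _ : Bond 3 (periodsT3 F K) => (LinearMap.id : W₂ →ₗ[ℂ] W₂)) := by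
  rw [DstarL2, adBgInv_one_eq]

omit [Fact (0 < cB)] in
/-- On any carrier, the adjoint of the flat `covDerivL2K` is the flat `covDivL2K` (real spacing). [cite: Balaban1985BackgroundPropagators, (3.8) p.392] -/
theorem adjoint_covDerivL2K_id {P : Fin 3 → ℕ} :
    LinearMap.adjoint (covDerivL2K ℂ c₀ (((eta F n K : ℝ) : ℂ)⁻¹) (fun _ : Bond 3 P => (LinearMap.id : W₂ →ₗ[ℂ] W₂))) =
      covDivL2K ℂ c₀ (((eta F n K : ℝ) : ℂ)⁻¹) (fun _ : Bond 3 P => (LinearMap.id : W₂ →ₗ[ℂ] W₂)) :=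
  adjoint_covDerivL2K (𝕜 := ℂ) _ (by rw [← Complex.ofReal_inv, Complex.conj_ofReal]) _ _ (fun _ _ _ => rfl)

omit [Fact (0 < c₀)] [Fact (0 < cB)] in
/-- The one-bond source across the cast: `Ψ(toL2 (δ_b Z)) = δ_{b₁} (frobEquiv⁻¹ Z)`, `b₁ := bondCast hP (bondEquiv F K b)`. [cite: Balaban1985BackgroundPropagators, (3.11) p.392] -/
theorem bondL2Cast_toL2_single (b : PBond (F.P K) 0) (Z : Matrix (Fin 2) (Fin 2) ℂ) :
    bondL2Cast ℂ (periodsT3_eq_towerP F n K hnK) (toL2 F K c₀ (Pi.single b Z)) =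
      (WL2.linearEquiv ℂ ℂ (fun _ : Bond 3 (towerP F.L (fun _ : Fin 3 => (F.P K).sitesPerDir (K - n)) (K - n - 1 + 1)) => c₀)).symm
        (Pi.single (bondCast (periodsT3_eq_towerP F n K hnK) (bondEquiv F K b)) (frobEquiv.symm Z)) := by
  classical
  apply (WL2.equiv ℂ _ W₂).injective
  rw [equiv_bondL2Cast, WL2.linearEquiv_symm_apply, Equiv.apply_symm_apply]
  funext q
  rw [Function.comp_apply, toL2_apply]
  by_cases hq : q = bondCast (periodsT3_eq_towerP F n K hnK) (bondEquiv F K b)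
  · rw [hq, Pi.single_eq_same, Equiv.symm_apply_apply, Equiv.symm_apply_apply, Pi.single_eq_same]
  · rw [Pi.single_eq_of_ne hq]
    have hq' : (bondEquiv F K).symm ((bondCast (periodsT3_eq_towerP F n K hnK)).symm q) ≠ b := by
      intro h; apply hq
      rw [← h, Equiv.apply_symm_apply, Equiv.apply_symm_apply]
    rw [Pi.single_eq_of_ne hq', map_zero]

/-- ★★ **THE ROUTE's FLAT `D_1((1 − R_S(1))(D_1*(δ_b Z)))` IS THE TOWER's `D_1((1 − R_k(1))(D_1†(δ_{b₁} z)))` ACROSS THE PERIOD CAST** (`Ψ := bondL2Cast hP`, `Φ := siteL2Cast hP`;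
✓`covDerivL2K_siteL2Cast`, ✓`covDivL2K_bondL2Cast`, ✓`adjoint_DL2`, FILE 3b ✓`siteL2Cast_RS_one`). [cite: Balaban1985BackgroundPropagators, (3.49) p.399, (3.21)–(3.25) p.394] -/
theorem bondL2Cast_DPDstar_one [NeZero F.L] (b : PBond (F.P K) 0) (Z : Matrix (Fin 2) (Fin 2) ℂ) :
    haveI : ∀ i : Fin 3, NeZero ((fun _ : Fin 3 => (F.P K).sitesPerDir (K - n)) i) := fun _ => inferInstance
    bondL2Cast ℂ (periodsT3_eq_towerP F n K hnK)
        (DL2 F n K c₀ 1 (DstarL2 F n K c₀ 1 (toL2 F K c₀ (Pi.single b Z)) -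
          RS F n K hnK.le c₀ cB 1 (DstarL2 F n K c₀ 1 (toL2 F K c₀ (Pi.single b Z))))) =
      covDerivL2K ℂ c₀ (((eta F n K : ℝ) : ℂ)⁻¹) (adTransportW frobEquiv (fun _ : Bond 3 (towerP F.L (fun _ : Fin 3 => (F.P K).sitesPerDir (K - n)) (K - n - 1 + 1)) => (1 : (Matrix (Fin 2) (Fin 2) ℂ)ˣ)))
        (LinearMap.adjoint (covDerivL2K ℂ c₀ (((eta F n K : ℝ) : ℂ)⁻¹) (adTransportW frobEquiv (fun _ : Bond 3 (towerP F.L (fun _ : Fin 3 => (F.P K).sitesPerDir (K - n)) (K - n - 1 + 1)) => (1 : (Matrix (Fin 2) (Fin 2) ℂ)ˣ))))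
            ((WL2.linearEquiv ℂ ℂ (fun _ : Bond 3 (towerP F.L (fun _ : Fin 3 => (F.P K).sitesPerDir (K - n)) (K - n - 1 + 1)) => c₀)).symm
              (Pi.single (bondCast (periodsT3_eq_towerP F n K hnK) (bondEquiv F K b)) (frobEquiv.symm Z))) -
          RofUk F.L (fun _ : Fin 3 => (F.P K).sitesPerDir (K - n)) (K - n - 1) frobEquiv (eta F n K)
            (fun _ : Bond 3 (towerP F.L (fun _ : Fin 3 => (F.P K).sitesPerDir (K - n)) (K - n - 1 + 1)) => (1 : (Matrix (Fin 2) (Fin 2) ℂ)ˣ)) (c₀ := c₀)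
            (LinearMap.adjoint (covDerivL2K ℂ c₀ (((eta F n K : ℝ) : ℂ)⁻¹) (adTransportW frobEquiv (fun _ : Bond 3 (towerP F.L (fun _ : Fin 3 => (F.P K).sitesPerDir (K - n)) (K - n - 1 + 1)) => (1 : (Matrix (Fin 2) (Fin 2) ℂ)ˣ))))
              ((WL2.linearEquiv ℂ ℂ (fun _ : Bond 3 (towerP F.L (fun _ : Fin 3 => (F.P K).sitesPerDir (K - n)) (K - n - 1 + 1)) => c₀)).symm
                (Pi.single (bondCast (periodsT3_eq_towerP F n K hnK) (bondEquiv F K b)) (frobEquiv.symm Z))))) := by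
  haveI : ∀ i : Fin 3, NeZero ((fun _ : Fin 3 => (F.P K).sitesPerDir (K - n)) i) := fun _ => inferInstance
  set hP := periodsT3_eq_towerP F n K hnK with hhP
  rw [adTransportW_one_eq, adjoint_covDerivL2K_id F n K c₀, ← bondL2Cast_toL2_single F n K hnK c₀ b Z]
  -- the right-hand side, read as casts of the route's objects
  set χ := toL2 F K c₀ (Pi.single b Z) with hχ
  have hDstar : covDivL2K ℂ c₀ (((eta F n K : ℝ) : ℂ)⁻¹) (fun _ : Bond 3 (towerP F.L (fun _ : Fin 3 => (F.P K).sitesPerDir (K - n)) (K - n - 1 + 1)) => (LinearMap.id : W₂ →ₗ[ℂ] W₂))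
      (bondL2Cast ℂ hP χ) = siteL2Cast ℂ hP (DstarL2 F n K c₀ 1 χ) := by
    rw [covDivL2K_bondL2Cast, DstarL2_one_eq]; rfl
  have hD : ∀ l : SiteL2K ℂ 3 (periodsT3 F K) c₀ W₂,
      covDerivL2K ℂ c₀ (((eta F n K : ℝ) : ℂ)⁻¹) (fun _ : Bond 3 (towerP F.L (fun _ : Fin 3 => (F.P K).sitesPerDir (K - n)) (K - n - 1 + 1)) => (LinearMap.id : W₂ →ₗ[ℂ] W₂))
        (siteL2Cast ℂ hP l) = bondL2Cast ℂ hP (DL2 F n K c₀ 1 l) := by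
    intro l; rw [covDerivL2K_siteL2Cast, DL2_one_eq]; rfl
  rw [hDstar, ← siteL2Cast_RS_one F n K hnK c₀ cB, ← map_sub, hD]

/-! ## §3 ★★★ `h349` at the flat member -/

/-- ★★★ **`h349` AT THE FLAT MEMBER `U₀ := 1`** — the EX display's row VERBATIM (S31ᴸ ✓p703595 :245–:250) with `U₀ := 1` and the `RegPr` antecedent dropped: for every block size
`L > 1` there are `C349 ≥ 0`, `δ349 > 0` such that for every member `i : Idx L`, every fine bonds `b bd` and `Z ∈ M₂(ℂ)`,
`‖(D_1((1 − R_S(1))(D_1*(δ_b Z))))(bd)‖ ≤ C349·((L:ℝ)^(K−n))⁻¹ ^ 3·e^{−δ349·tdist(B^{K−n}(b₋), B^{K−n}(bd₋))}·‖Z‖` — [Balaban1985BackgroundPropagators] (3.49) for `P = 1 − R_S` in the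
`η^d`-kernel convention, `K`-uniform, constants functions of `L` (and the weight letter `c₀ L`) only.  FILE 2 on the tower carrier + §2 + §1.
[cite: Balaban1985BackgroundPropagators, (3.49) p.399, (3.21) p.394, (3.11) p.392; Balaban1985Variational, p.299 l.13] -/
theorem h349_at_one (c₀ cB : ℕ → ℝ) [hc₀ : ∀ L : ℕ, Fact (0 < c₀ L)] [hcB : ∀ L : ℕ, Fact (0 < cB L)] :
    ∀ (L : ℕ), 1 < L → ∃ C349 δ349 : ℝ, 0 ≤ C349 ∧ 0 < δ349 ∧
      ∀ (i : Idx L) (b : PBond (i.1.1.P i.1.2.2) 0) (Z : Matrix (Fin 2) (Fin 2) ℂ) (bd : PBond (i.1.1.P i.1.2.2) 0),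
        ‖(toL2 i.1.1 i.1.2.2 (c₀ L)).symm (DL2 i.1.1 i.1.2.1 i.1.2.2 (c₀ L) 1
            (DstarL2 i.1.1 i.1.2.1 i.1.2.2 (c₀ L) 1 (toL2 i.1.1 i.1.2.2 (c₀ L) (Pi.single b Z))
              - RS i.1.1 i.1.2.1 i.1.2.2 i.2.2.le (c₀ L) (cB L) 1 (DstarL2 i.1.1 i.1.2.1 i.1.2.2 (c₀ L) 1 (toL2 i.1.1 i.1.2.2 (c₀ L) (Pi.single b Z))))) bd‖
          ≤ C349 * ((L : ℝ) ^ (i.1.2.2 - i.1.2.1))⁻¹ ^ 3 *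
              Real.exp (-(δ349 * (Site.tdist (iterBlockOf (i.1.2.2 - i.1.2.1) b.src) (iterBlockOf (i.1.2.2 - i.1.2.1) bd.src) : ℝ))) * ‖Z‖ := by
  intro L hL
  by_cases hL3 : 3 ≤ L
  swap
  · -- no member has an even or too small `L`: the statement is vacuous
    refine ⟨0, 1, le_rfl, one_pos, fun i => ?_⟩
    exfalso
    obtain ⟨⟨F, n, K⟩, hF, -⟩ := i
    have h1 := F.hL.1; have h2 := F.hL.2
    rw [show F.L = L from hF] at h1 h2
    rcases h1 with ⟨k, hk⟩
    omega
  haveI : NeZero L := ⟨by omega⟩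
  -- the fibre letters of record: `φ := frobEquiv` (`M_φ = 1`, `M_φ′ = √2`), `τ := trace` (`C_τ = 2`), `a′ := 1`, `ρ_w := (c₀ L)⁻¹`
  have hτφ : ∀ X Y : Matrix (Fin 2) (Fin 2) ℂ, ⟪frobEquiv.symm X, frobEquiv.symm Y⟫_ℂ = Matrix.traceLinearMap (Fin 2) ℂ ℂ (star X * Y) := fun X Y => by
    rw [Prop7SectET3HilbertLetters.inner_frobEquiv_symm, Matrix.traceLinearMap_apply, Matrix.star_eq_conjTranspose]
  have htr : ∀ X Y : Matrix (Fin 2) (Fin 2) ℂ, Matrix.traceLinearMap (Fin 2) ℂ ℂ (X * Y) = Matrix.traceLinearMap (Fin 2) ℂ ℂ (Y * X) := fun X Y => by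
    rw [Matrix.traceLinearMap_apply, Matrix.traceLinearMap_apply, Matrix.trace_mul_comm]
  have hτ₁ : ∀ X : Matrix (Fin 2) (Fin 2) ℂ, Matrix.traceLinearMap (Fin 2) ℂ ℂ (star X) = conj (Matrix.traceLinearMap (Fin 2) ℂ ℂ X) := fun X => by
    rw [Matrix.traceLinearMap_apply, Matrix.traceLinearMap_apply, Matrix.star_eq_conjTranspose, Matrix.trace_conjTranspose]; rfl
  have hτ : ∀ X : Matrix (Fin 2) (Fin 2) ℂ, ‖Matrix.traceLinearMap (Fin 2) ℂ ℂ X‖ ≤ 2 * ‖X‖ := fun X => by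
    have h := norm_trace_clm_le X
    rwa [LinearMap.coe_toContinuousLinearMap'] at h
  have hφ : ∀ w : W₂, ‖frobEquiv w‖ ≤ 1 * ‖w‖ := fun w => by rw [one_mul]; exact norm_frobEquiv_le w
  have hφ' : ∀ X : Matrix (Fin 2) (Fin 2) ℂ, ‖frobEquiv.symm X‖ ≤ Real.sqrt 2 * ‖X‖ := norm_frobEquiv_symm_le
  have hc₀L : 0 < c₀ L := (hc₀ L).out
  obtain ⟨C, δ, hC, hδ, H⟩ := exists_pointRow_DPDstar_tower_one (d := 3) (by norm_num) L (by omega) hL3 frobEquiv zero_le_one (Real.sqrt_nonneg 2) hφ hφ'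
    one_pos (Matrix.traceLinearMap (Fin 2) ℂ ℂ) hτ zero_le_two (le_refl (0 : ℝ)) (inv_nonneg.2 hc₀L.le) hτ₁ htr hτφ
  refine ⟨C * Real.sqrt 2 * Real.exp (2 * δ), δ / 3, by positivity, by positivity, ?_⟩
  rintro ⟨⟨F, n, K⟩, hF, hnK⟩ b Z bd
  simp only at hF hnK b Z bd ⊢
  subst hF
  haveI : NeZero F.L := ⟨by omega⟩
  haveI : ∀ i : Fin 3, NeZero ((fun _ : Fin 3 => (F.P K).sitesPerDir (K - n)) i) := fun _ => inferInstance
  have hKn : K - n - 1 + 1 = K - n := by omega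
  have hm : ∀ i : Fin 3, 1 ≤ (fun _ : Fin 3 => (F.P K).sitesPerDir (K - n)) i := fun _ => Nat.one_le_iff_ne_zero.2 (NeZero.ne _)
  have hηL : eta F n K * (F.L : ℝ) ^ (K - n - 1 + 1) = 1 := by
    rw [hKn, eta, ← mul_pow, inv_mul_cancel₀ (by exact_mod_cast (show F.L ≠ 0 by omega)), one_pow]
  have hη1 : |eta F n K| ^ 3 / c₀ F.L ≤ (c₀ F.L)⁻¹ := by
    rw [abs_of_pos (eta_pos F n K), div_eq_mul_inv]
    have : eta F n K ^ 3 ≤ 1 := by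
      refine pow_le_one₀ (eta_pos F n K).le ?_
      rw [eta]
      exact pow_le_one₀ (inv_nonneg.2 (by positivity)) (inv_le_one_of_one_le₀ (by exact_mod_cast (show 1 ≤ F.L by omega)))
    calc eta F n K ^ 3 * (c₀ F.L)⁻¹ ≤ 1 * (c₀ F.L)⁻¹ := mul_le_mul_of_nonneg_right this (inv_nonneg.2 hc₀L.le)
      _ = (c₀ F.L)⁻¹ := one_mul _
  set hP := periodsT3_eq_towerP F n K hnK with hhP
  set b₁ : Bond 3 (towerP F.L (fun _ : Fin 3 => (F.P K).sitesPerDir (K - n)) (K - n - 1 + 1)) := bondCast hP (bondEquiv F K b) with hb₁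
  set bd₁ : Bond 3 (towerP F.L (fun _ : Fin 3 => (F.P K).sitesPerDir (K - n)) (K - n - 1 + 1)) := bondCast hP (bondEquiv F K bd) with hbd₁
  -- FILE 2 at the member
  haveI : Fact (0 < c₀ F.L * ((F.L : ℝ) ^ (K - n - 1 + 1)) ^ 3) := ⟨by positivity⟩
  have hrow := H (K - n - 1) (eta F n K) hηL (c₀ F.L) (c₀ F.L * ((F.L : ℝ) ^ (K - n - 1 + 1)) ^ 3) rfl hη1 (fun _ : Fin 3 => (F.P K).sitesPerDir (K - n)) hm
    b₁ bd₁ (frobEquiv.symm Z)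
  -- the route's vector across the cast
  have hcast := bondL2Cast_DPDstar_one F n K hnK (c₀ F.L) (cB F.L) b Z
  set V := DL2 F n K (c₀ F.L) 1 (DstarL2 F n K (c₀ F.L) 1 (toL2 F K (c₀ F.L) (Pi.single b Z)) -
    RS F n K hnK.le (c₀ F.L) (cB F.L) 1 (DstarL2 F n K (c₀ F.L) 1 (toL2 F K (c₀ F.L) (Pi.single b Z)))) with hV
  rw [← hcast] at hrow
  -- read the route's value at `bd` through the cast
  have hread : (toL2 F K (c₀ F.L)).symm V bd = frobEquiv (WL2.equiv ℂ _ W₂ (bondL2Cast ℂ hP V) bd₁) := by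
    rw [toL2_symm_apply, equiv_bondL2Cast, Function.comp_apply, hbd₁, Equiv.symm_apply_apply]
  rw [hread]
  refine (norm_frobEquiv_le _).trans (hrow.trans ?_)
  -- distances: tip blocks → base blocks → the display's `ℓ¹` block distance
  have htt : tdist (fun _ : Fin 3 => (F.P K).sitesPerDir (K - n))
      (blockCoord (F.L ^ (K - n - 1 + 1)) _ (siteCast (towerP_eq_fineP_pow F.L _ (K - n - 1 + 1)) (bpos b₁)))
      (blockCoord (F.L ^ (K - n - 1 + 1)) _ (siteCast (towerP_eq_fineP_pow F.L _ (K - n - 1 + 1)) (bpos bd₁))) ≤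
      tdist (fun _ : Fin 3 => (F.P K).sitesPerDir (K - n))
        (blockCoord (F.L ^ (K - n - 1 + 1)) _ (siteCast (towerP_eq_fineP_pow F.L _ (K - n - 1 + 1)) (btgt bd₁)))
        (blockCoord (F.L ^ (K - n - 1 + 1)) _ (siteCast (towerP_eq_fineP_pow F.L _ (K - n - 1 + 1)) (btgt b₁))) + 2 := by
    have h1 := tdist_bigBlock_bpos_btgt_le_one F.L _ (K - n - 1 + 1) hm b₁
    have h2 := tdist_bigBlock_bpos_btgt_le_one F.L _ (K - n - 1 + 1) hm bd₁
    have t1 := tdist_triangle hm (blockCoord (F.L ^ (K - n - 1 + 1)) _ (siteCast (towerP_eq_fineP_pow F.L _ (K - n - 1 + 1)) (bpos b₁)))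
      (blockCoord (F.L ^ (K - n - 1 + 1)) _ (siteCast (towerP_eq_fineP_pow F.L _ (K - n - 1 + 1)) (btgt b₁)))
      (blockCoord (F.L ^ (K - n - 1 + 1)) _ (siteCast (towerP_eq_fineP_pow F.L _ (K - n - 1 + 1)) (bpos bd₁)))
    have t2 := tdist_triangle hm (blockCoord (F.L ^ (K - n - 1 + 1)) _ (siteCast (towerP_eq_fineP_pow F.L _ (K - n - 1 + 1)) (btgt b₁)))
      (blockCoord (F.L ^ (K - n - 1 + 1)) _ (siteCast (towerP_eq_fineP_pow F.L _ (K - n - 1 + 1)) (btgt bd₁)))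
      (blockCoord (F.L ^ (K - n - 1 + 1)) _ (siteCast (towerP_eq_fineP_pow F.L _ (K - n - 1 + 1)) (bpos bd₁)))
    have s1 := tdist_symm hm (blockCoord (F.L ^ (K - n - 1 + 1)) _ (siteCast (towerP_eq_fineP_pow F.L _ (K - n - 1 + 1)) (btgt bd₁)))
      (blockCoord (F.L ^ (K - n - 1 + 1)) _ (siteCast (towerP_eq_fineP_pow F.L _ (K - n - 1 + 1)) (bpos bd₁)))
    have s2 := tdist_symm hm (blockCoord (F.L ^ (K - n - 1 + 1)) _ (siteCast (towerP_eq_fineP_pow F.L _ (K - n - 1 + 1)) (btgt b₁)))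
      (blockCoord (F.L ^ (K - n - 1 + 1)) _ (siteCast (towerP_eq_fineP_pow F.L _ (K - n - 1 + 1)) (btgt bd₁)))
    linarith
  have hsrc : (Site.tdist (iterBlockOf (K - n) b.src) (iterBlockOf (K - n) bd.src) : ℝ) ≤
      3 * tdist (fun _ : Fin 3 => (F.P K).sitesPerDir (K - n))
        (blockCoord (F.L ^ (K - n - 1 + 1)) _ (siteCast (towerP_eq_fineP_pow F.L _ (K - n - 1 + 1)) (bpos b₁)))
        (blockCoord (F.L ^ (K - n - 1 + 1)) _ (siteCast (towerP_eq_fineP_pow F.L _ (K - n - 1 + 1)) (bpos bd₁))) := by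
    have h := tdist_iterBlockOf_le F n K hnK b.src bd.src
    rw [hb₁, hbd₁, bondCast_apply, bondCast_apply]
    simpa [bpos, bpos_bondEquiv] using h
  -- assemble the constants
  have hexp : Real.exp (-(δ * tdist (fun _ : Fin 3 => (F.P K).sitesPerDir (K - n))
        (blockCoord (F.L ^ (K - n - 1 + 1)) _ (siteCast (towerP_eq_fineP_pow F.L _ (K - n - 1 + 1)) (btgt bd₁)))
        (blockCoord (F.L ^ (K - n - 1 + 1)) _ (siteCast (towerP_eq_fineP_pow F.L _ (K - n - 1 + 1)) (btgt b₁))))) ≤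
      Real.exp (2 * δ) * Real.exp (-(δ / 3 * (Site.tdist (iterBlockOf (K - n) b.src) (iterBlockOf (K - n) bd.src) : ℝ))) := by
    rw [← Real.exp_add]
    exact Real.exp_le_exp.2 (by nlinarith [hδ.le])
  have hpow : (((F.L : ℝ) ^ (K - n - 1 + 1)) ^ 3)⁻¹ = ((F.L : ℝ) ^ (K - n))⁻¹ ^ 3 := by rw [hKn, inv_pow]
  have hZ : ‖(frobEquiv.symm Z : W₂)‖ ≤ Real.sqrt 2 * ‖Z‖ := hφ' Z
  have hL0 : (0 : ℝ) ≤ ((F.L : ℝ) ^ (K - n))⁻¹ ^ 3 := by positivity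
  rw [hpow]
  calc C * (((F.L : ℝ) ^ (K - n))⁻¹ ^ 3) * Real.exp (-(δ * tdist (fun _ : Fin 3 => (F.P K).sitesPerDir (K - n))
          (blockCoord (F.L ^ (K - n - 1 + 1)) _ (siteCast (towerP_eq_fineP_pow F.L _ (K - n - 1 + 1)) (btgt bd₁)))
          (blockCoord (F.L ^ (K - n - 1 + 1)) _ (siteCast (towerP_eq_fineP_pow F.L _ (K - n - 1 + 1)) (btgt b₁))))) * ‖(frobEquiv.symm Z : W₂)‖
      ≤ C * (((F.L : ℝ) ^ (K - n))⁻¹ ^ 3) * (Real.exp (2 * δ) * Real.exp (-(δ / 3 * (Site.tdist (iterBlockOf (K - n) b.src) (iterBlockOf (K - n) bd.src) : ℝ)))) *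
          (Real.sqrt 2 * ‖Z‖) := by gcongr
    _ = C * Real.sqrt 2 * Real.exp (2 * δ) * ((F.L : ℝ) ^ (K - n))⁻¹ ^ 3 *
          Real.exp (-(δ / 3 * (Site.tdist (iterBlockOf (K - n) b.src) (iterBlockOf (K - n) bd.src) : ℝ))) * ‖Z‖ := by ring

/-- **Row `h349` on the flat orbit, in the EX display's letter shape (S33ᴸ, l.243–246).**
Skolemising `h349_at_one`: there are functions `C349 δ349 : ℕ → ℝ` with `0 ≤ C349 L` and
`0 < δ349 L` whenever `1 < L`, such that for every `1 < L` and every index `i : Idx L` the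
[Balaban1985BackgroundPropagators] (3.49) one-bond row of the one-level member holds at the
flat background `U₀ := 1` — i.e. the display's binder `h349` restricted to `U₀ = 1`, with its
letters `(C349 δ349 : ℕ → ℝ)`, `hC349`, `hδ349` supplied (the `RegPr` premise is not needed on
the flat orbit). -/
theorem h349_at_one_letters (c₀ cB : ℕ → ℝ) [hc₀ : ∀ L : ℕ, Fact (0 < c₀ L)]
    [hcB : ∀ L : ℕ, Fact (0 < cB L)] :
    ∃ C349 δ349 : ℕ → ℝ, (∀ L : ℕ, 1 < L → 0 ≤ C349 L) ∧ (∀ L : ℕ, 1 < L → 0 < δ349 L) ∧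
      ∀ (L : ℕ), 1 < L → ∀ (i : Idx L) (b : PBond (i.1.1.P i.1.2.2) 0)
        (Z : Matrix (Fin 2) (Fin 2) ℂ) (bd : PBond (i.1.1.P i.1.2.2) 0),
        ‖(toL2 i.1.1 i.1.2.2 (c₀ L)).symm (DL2 i.1.1 i.1.2.1 i.1.2.2 (c₀ L) 1
            (DstarL2 i.1.1 i.1.2.1 i.1.2.2 (c₀ L) 1 (toL2 i.1.1 i.1.2.2 (c₀ L) (Pi.single b Z))
              - RS i.1.1 i.1.2.1 i.1.2.2 i.2.2.le (c₀ L) (cB L) 1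
                  (DstarL2 i.1.1 i.1.2.1 i.1.2.2 (c₀ L) 1
                    (toL2 i.1.1 i.1.2.2 (c₀ L) (Pi.single b Z))))) bd‖
          ≤ C349 L * ((L : ℝ) ^ (i.1.2.2 - i.1.2.1))⁻¹ ^ 3 *
              Real.exp (-(δ349 L * (Site.tdist (iterBlockOf (i.1.2.2 - i.1.2.1) b.src)
                (iterBlockOf (i.1.2.2 - i.1.2.1) bd.src) : ℝ))) * ‖Z‖ := by
  classical
  have h := h349_at_one c₀ cB
  refine ⟨fun L => if hL : 1 < L then (h L hL).choose else 0,
    fun L => if hL : 1 < L then (h L hL).choose_spec.choose else 1, ?_, ?_, ?_⟩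
  · intro L hL
    simp only [dif_pos hL]
    exact (h L hL).choose_spec.choose_spec.1
  · intro L hL
    simp only [dif_pos hL]
    exact (h L hL).choose_spec.choose_spec.2.1
  · intro L hL i b Z bd
    simp only [dif_pos hL]
    exact (h L hL).choose_spec.choose_spec.2.2 i b Z bd

end Summit.QuantumFields.YangMills.Theorems.Prop7Flat349Certificate

end
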